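import Summits.ResolutionOfSingularities.ResolutionOfSingularities.Theorems.PAlterationPialtRegularModel
import Literature.AlgebraicGeometry.Resolution.ValuedFunctionFields
import Mathlib.FieldTheory.PurelyInseparable.Basic
import HarnessLib

/-!
# `PalterationThesis` (crux stmt-ResolutionOfSingularities-0552), line `Sketch` rev. c4: RRLU1 over a
# field `K` IS "local uniformizability descends one radicial step"

Helper file of the line lead (c4) for the skeleton `Cruxes/PalterationThesis/Lines/Sketch.lean`
(`--supports stmt-ResolutionOfSingularities-0552`; it does not close the item). The atom `RRLU1_K`
of rev. c3 and its zero-dimensional non-Abhyankar core of rev. c4 carry a regular finitely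
generated affine model `B ⊆ O` of the TOP field `L` of the height-one purely inseparable
extension `L/F`. This file records, sorry-free, that this datum is exactly local
uniformizability of `O` itself over `K`: so `RRLU1_K` is literally the statement

  "for `K ⊆ F ⊆ L`, `F/K` finitely generated, `L = F(y)` with `y ^ p ∈ F`, and a valuation ring
   `O ∋ K` of `L`: if `O` is locally uniformizable over `K` then so is `O ∩ F`"

(`rrLU1At_iff_descends`), and likewise for the core (`rrLU1CoreAt_iff_descendsCore`). The passage
from a model regular AT THE CENTRE to an everywhere regular model inside `O` is item 0555's
`exists_regularModel_of_isLocallyUniformizable` (openness of the regular locus of a finitely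
generated algebra over a field); the converse is the definition of `IsRegularRing`.

By the Frobenius twist over a perfect `K` (rev. c2, `r1D_iff_r1U`), descending one radicial step
for all such towers is the same problem as ASCENDING one radicial step — Cossart–Piltant's local
uniformization of purely inseparable coverings `z ^ p = f` of regular varieties (J. Algebra 320
(2008) / 321 (2009), transcendence degree `3`).

Sources: O. Zariski, P. Samuel, *Commutative Algebra* II, Ch. VI §17; V. Cossart, O. Piltant,
J. Algebra 320 (2008) 1051–1082, Thm. on p. 1052 (reduction to purely inseparable / Artin–Schreier
coverings). The lemmas themselves are folklore.
-/

set_option linter.dupNamespace false -- mandated namespace of this single-conjunct summit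

noncomputable section

open IsLocalRing
open Literature.AlgebraicGeometry.Resolution
open Summit.ResolutionOfSingularities.ResolutionOfSingularities.Theorems.Pialt.RadiciallyRegular
  (exists_regularModel_of_isLocallyUniformizable)

namespace Summit.ResolutionOfSingularities.ResolutionOfSingularities.Theorems.PalterationThesis.PerfectAtoms

/-- **An everywhere regular finitely generated affine model inside a valuation ring uniformizes
it**: if `B ⊆ O` is a finitely generated `K`-subalgebra of `L` with `Frac B = L` and `B` a
regular ring, then `O` is locally uniformizable over `K` (the localisation of `B` at the centre
of `O` is regular by definition of `IsRegularRing`). [folklore] -/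
theorem isLocallyUniformizable_of_regularModel (K L : Type) [Field K] [Field L] [Algebra K L]
    (O : ValuationSubring L) (B : Subalgebra K L) (hBfg : B.FG) (hBfr : IsFractionRing B L)
    (hBreg : IsRegularRing B) (hBO : B.toSubring ≤ O.toSubring) :
    IsLocallyUniformizable K L O :=
  ⟨B, hBO, hBfg, hBfr, IsRegularRing.isRegularLocalRing_localization (R := B) _⟩

/-- **`RRLU1_K` ⟺ local uniformizability over `K` descends along every height-one purely
inseparable extension `L/F` of finitely generated fields over `K`** (from every valuation ring
`O ∋ K` of `L` to its trace `O ∩ F`). `→`: a valuation ring that is locally uniformizable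
contains an everywhere regular finitely generated model of `L`
(`exists_regularModel_of_isLocallyUniformizable`), to which `RRLU1_K` applies; `←`: a regular
model `B ⊆ O` uniformizes `O` (`isLocallyUniformizable_of_regularModel`). Any field `K`.
[folklore] -/
theorem rrLU1At_iff_descends (p : ℕ) (K : Type) [Field K] :
    (∀ (F L : Type) [Field F] [Field L] [Algebra K F] [Algebra F L] [Algebra K L]
      [IsScalarTower K F L], (⊤ : IntermediateField K F).FG → IsPurelyInseparable F L →
      (∃ y : L, y ^ p ∈ (algebraMap F L).range ∧ IntermediateField.adjoin F {y} = ⊤) →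
      ∀ B : Subalgebra K L, B.FG → IsFractionRing B L → IsRegularRing B →
      ∀ O : ValuationSubring L, B.toSubring ≤ O.toSubring →
        IsLocallyUniformizable K F (O.comap (algebraMap F L))) ↔
    (∀ (F L : Type) [Field F] [Field L] [Algebra K F] [Algebra F L] [Algebra K L]
      [IsScalarTower K F L], (⊤ : IntermediateField K F).FG → IsPurelyInseparable F L →
      (∃ y : L, y ^ p ∈ (algebraMap F L).range ∧ IntermediateField.adjoin F {y} = ⊤) →
      ∀ O : ValuationSubring L, (∀ c : K, algebraMap K L c ∈ O) →
        IsLocallyUniformizable K L O → IsLocallyUniformizable K F (O.comap (algebraMap F L))) := by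
  constructor
  · intro h F L _ _ _ _ _ _ hfg hpi hy O _ hLU
    obtain ⟨B, hBO, hBfg, hBfr, hBreg⟩ := exists_regularModel_of_isLocallyUniformizable K L O hLU
    exact h F L hfg hpi hy B hBfg hBfr hBreg O hBO
  · intro h F L _ _ _ _ _ _ hfg hpi hy B hBfg hBfr hBreg O hBO
    exact h F L hfg hpi hy O (fun c => hBO (B.algebraMap_mem c))
      (isLocallyUniformizable_of_regularModel K L O B hBfg hBfr hBreg hBO)

/-- **The rev. c4 core of `RRLU1_K` ⟺ local uniformizability descends one radicial step at
zero-dimensional valuation rings whose trace is not an Abhyankar place** (same proof, the extra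
hypotheses riding along). Any field `K`. [folklore] -/
theorem rrLU1CoreAt_iff_descendsCore (p : ℕ) (K : Type) [Field K] :
    (∀ (F L : Type) [Field F] [Field L] [Algebra K F] [Algebra F L] [Algebra K L]
      [IsScalarTower K F L], (⊤ : IntermediateField K F).FG → IsPurelyInseparable F L →
      (∃ y : L, y ^ p ∈ (algebraMap F L).range ∧ IntermediateField.adjoin F {y} = ⊤) →
      ∀ B : Subalgebra K L, B.FG → IsFractionRing B L → IsRegularRing B →
      ∀ O : ValuationSubring L, B.toSubring ≤ O.toSubring →
        (∀ x ∈ O, ∃ f : Polynomial K, f ≠ 0 ∧ Polynomial.aeval x f ∈ O.nonunits) →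
        (∀ x ∈ O.comap (algebraMap F L), ∃ f : Polynomial K, f ≠ 0 ∧
          Polynomial.aeval x f ∈ (O.comap (algebraMap F L)).nonunits) →
        ¬ IsAbhyankarPlace (O.comap (algebraMap F L)) (algebraMap K F).fieldRange ⊤ →
        IsLocallyUniformizable K F (O.comap (algebraMap F L))) ↔
    (∀ (F L : Type) [Field F] [Field L] [Algebra K F] [Algebra F L] [Algebra K L]
      [IsScalarTower K F L], (⊤ : IntermediateField K F).FG → IsPurelyInseparable F L →
      (∃ y : L, y ^ p ∈ (algebraMap F L).range ∧ IntermediateField.adjoin F {y} = ⊤) →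
      ∀ O : ValuationSubring L, (∀ c : K, algebraMap K L c ∈ O) →
        (∀ x ∈ O, ∃ f : Polynomial K, f ≠ 0 ∧ Polynomial.aeval x f ∈ O.nonunits) →
        (∀ x ∈ O.comap (algebraMap F L), ∃ f : Polynomial K, f ≠ 0 ∧
          Polynomial.aeval x f ∈ (O.comap (algebraMap F L)).nonunits) →
        ¬ IsAbhyankarPlace (O.comap (algebraMap F L)) (algebraMap K F).fieldRange ⊤ →
        IsLocallyUniformizable K L O → IsLocallyUniformizable K F (O.comap (algebraMap F L))) := by
  constructor
  · intro h F L _ _ _ _ _ _ hfg hpi hy O _ h0L h0F hA hLU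
    obtain ⟨B, hBO, hBfg, hBfr, hBreg⟩ := exists_regularModel_of_isLocallyUniformizable K L O hLU
    exact h F L hfg hpi hy B hBfg hBfr hBreg O hBO h0L h0F hA
  · intro h F L _ _ _ _ _ _ hfg hpi hy B hBfg hBfr hBreg O hBO h0L h0F hA
    exact h F L hfg hpi hy O (fun c => hBO (B.algebraMap_mem c)) h0L h0F hA
      (isLocallyUniformizable_of_regularModel K L O B hBfg hBfr hBreg hBO)

end Summit.ResolutionOfSingularities.ResolutionOfSingularities.Theorems.PalterationThesis.PerfectAtoms

end
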